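import Mathlib.Algebra.Polynomial.Derivative
import Mathlib.Algebra.Polynomial.Div
import Mathlib.Algebra.Polynomial.AlgebraMap
import Mathlib.Algebra.Ring.GeomSum
import Mathlib.Data.Nat.Choose.Factorization
import Mathlib.Data.Nat.Choose.Sum
import Mathlib.Data.Nat.Cast.Field
import Mathlib.RingTheory.Ideal.Span
import Mathlib.RingTheory.Coprime.Lemmas
import Mathlib.RingTheory.Polynomial.Tower
import Mathlib.RingTheory.Ideal.BigOperators
import Mathlib.Tactic.FieldSimp
import Mathlib.Tactic.LinearCombination
import Mathlib.Tactic.Positivity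
import HarnessLib

/-!
# Truncated logarithms: `log((1+X)ⁿ) ≡ n·log(1+X) (mod X^(N+1))` and `(1+v)^(p^K) → 1`

Two elementary algebraic identities behind Fontaine's element `t = log [ε] ∈ B_dR⁺` and its
transformation law `σ(t) = χ(σ)·t` (Fontaine 1994, Exp. II, 1.5.4–1.5.5), isolated here so that
the construction of `t` needs no analytic function theory:

* `TruncatedLog.logTrunc N = Σ_{m<N} (-1)^m X^(m+1)/(m+1) ∈ ℚ[X]` (the logarithm series truncated
  modulo `X^(N+1)`) and its integral multiple `logTruncInt N = N!·logTrunc N ∈ ℤ[X]`;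
* `TruncatedLog.X_pow_dvd` / `X_pow_dvd_int`: for every `n : ℕ`,
  `X^(N+1) ∣ L_N((1+X)ⁿ - 1) - n·L_N(X)` — the functional equation of the logarithm for natural
  exponents, truncated; proved by formal differentiation
  (`(1+X)·L_N' = 1 - (-X)^N`) and comparison of coefficients in characteristic `0`, then descended
  to `ℤ[X]`;
* `TruncatedLog.exists_aeval_sub_eq`: its evaluation in any commutative ring;
* `TruncatedLog.exists_one_add_pow_prime_pow`: in any commutative ring,
  `(1+v)^(p^K) - 1 ∈ (p^(K-N), v^(N+1))` (Kummer: `p^(K - v_p j) ∣ (p^K choose j)`), the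
  `p`-adic continuity of `a ↦ (1+v)^a` modulo `v^(N+1)`.

These are [folklore]; they are used in `Literature.NumberTheory.PAdicHodge` to pass from the
transformation law `σ[ε] = [ε^χ(σ)]` in `𝔸_inf` to `σ(t) = χ(σ)t` in `B_dR⁺`.

## References
* J.-M. Fontaine, *Le corps des périodes p-adiques*, Astérisque 223 (1994), Exp. II, §1.5.4–1.5.5.
-/

noncomputable section

open Polynomial Finset
open scoped Nat

namespace Literature.NumberTheory.PAdicHodge

namespace TruncatedLog

/-- The truncated logarithm `L_N(X) = Σ_{m<N} (-1)^m X^(m+1)/(m+1) ∈ ℚ[X]`, i.e. `log(1+X)`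
modulo `X^(N+1)`. [folklore] -/
def logTrunc (N : ℕ) : ℚ[X] := ∑ m ∈ range N, C ((-1 : ℚ) ^ m / (m + 1)) * X ^ (m + 1)

/-- `N! · L_N(X)`, a polynomial with integer coefficients. [folklore] -/
def logTruncInt (N : ℕ) : ℤ[X] :=
  ∑ m ∈ range N, C ((-1 : ℤ) ^ m * ((N ! / (m + 1) : ℕ) : ℤ)) * X ^ (m + 1)

/-- `L_N'(X) = Σ_{m<N} (-X)^m`. [folklore] -/
theorem derivative_logTrunc (N : ℕ) :
    derivative (logTrunc N) = ∑ m ∈ range N, (-X : ℚ[X]) ^ m := by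
  simp only [logTrunc, derivative_sum, derivative_C_mul_X_pow, Nat.add_sub_cancel]
  refine sum_congr rfl fun m _ => ?_
  have hm : (m : ℚ) + 1 ≠ 0 := Nat.cast_add_one_ne_zero m
  rw [Nat.cast_add, Nat.cast_one, div_mul_cancel₀ _ hm, map_pow, map_neg, map_one, neg_pow (X : ℚ[X]) m]

/-- `(1 + X)·L_N'(X) = 1 - (-X)^N`. [folklore] -/
theorem one_add_X_mul_derivative_logTrunc (N : ℕ) :
    (1 + X) * derivative (logTrunc N) = 1 - (-X : ℚ[X]) ^ N := by
  rw [derivative_logTrunc, ← mul_neg_geom_sum, sub_neg_eq_add]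

/-- `L_N(0) = 0`. [folklore] -/
theorem eval_zero_logTrunc (N : ℕ) : eval 0 (logTrunc N) = 0 := by
  simp [logTrunc, eval_finsetSum]

/-- **Truncated functional equation** over `ℚ`: `X^(N+1) ∣ L_N((1+X)ⁿ - 1) - n·L_N(X)`.
Proof: with `P` the right-hand side, `(1+X)·P' = n·((-X)^N - (-Y)^N)` where `Y = (1+X)ⁿ - 1` is
divisible by `X`; hence `X^N ∣ P'`, and `P(0) = 0`. [folklore] -/
theorem X_pow_dvd (n N : ℕ) :
    X ^ (N + 1) ∣ (logTrunc N).comp ((1 + X) ^ n - 1) - (n : ℚ[X]) * logTrunc N := by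
  obtain ⟨Y, hY⟩ : ∃ Y : ℚ[X], Y = (1 + X) ^ n - 1 := ⟨_, rfl⟩
  obtain ⟨P, hP⟩ : ∃ P : ℚ[X], P = (logTrunc N).comp Y - (n : ℚ[X]) * logTrunc N := ⟨_, rfl⟩
  rw [← hY, ← hP]
  have h1 : derivative Y = (n : ℚ[X]) * (1 + X) ^ (n - 1) := by
    rw [hY, derivative_sub, derivative_one, sub_zero, derivative_pow, derivative_add,
      derivative_one, derivative_X, zero_add, mul_one, map_natCast]
  have h3 : (1 + X : ℚ[X]).comp Y = (1 + X) ^ n := by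
    rw [add_comp, one_comp, X_comp, hY, add_sub_cancel]
  have h4 : (1 + X) ^ n * (derivative (logTrunc N)).comp Y = 1 - (-Y) ^ N := by
    rw [← h3, ← mul_comp, one_add_X_mul_derivative_logTrunc, sub_comp, one_comp, pow_comp,
      neg_comp, X_comp]
  have h6 := one_add_X_mul_derivative_logTrunc N
  have hder : (1 + X) * derivative P = (n : ℚ[X]) * ((-X) ^ N - (-Y) ^ N) := by
    rw [hP, derivative_sub, derivative_mul, derivative_natCast, zero_mul, zero_add,
      derivative_comp, h1]
    rcases Nat.eq_zero_or_pos n with rfl | hn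
    · simp
    · have h5 : (1 + X : ℚ[X]) * (1 + X) ^ (n - 1) = (1 + X) ^ n := by
        rw [← pow_succ', Nat.sub_add_cancel hn]
      linear_combination ((n : ℚ[X]) * (derivative (logTrunc N)).comp Y) * h5 +
        (n : ℚ[X]) * h4 - (n : ℚ[X]) * h6
  have hXY : X ∣ Y := by
    rw [X_dvd_iff, coeff_zero_eq_eval_zero, hY]
    simp
  have hXN : X ^ N ∣ derivative P * (1 + X) := by
    rw [mul_comm, hder]
    refine Dvd.dvd.mul_left (_root_.dvd_sub ?_ ?_) _
    · exact pow_dvd_pow_of_dvd (dvd_neg.2 dvd_rfl) N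
    · exact pow_dvd_pow_of_dvd (dvd_neg.2 hXY) N
  have hcop : IsCoprime (X ^ N : ℚ[X]) (1 + X) := IsCoprime.pow_left ⟨-1, 1, by ring⟩
  have hdP : X ^ N ∣ derivative P := hcop.dvd_of_dvd_mul_right hXN
  have hP0 : P.coeff 0 = 0 := by
    have hY0 : eval 0 Y = 0 := by rw [hY]; simp
    rw [coeff_zero_eq_eval_zero, hP, eval_sub, eval_comp, eval_mul, eval_natCast, hY0,
      eval_zero_logTrunc, mul_zero, sub_zero]
  rw [X_pow_dvd_iff]
  intro d hd
  rcases d with _ | d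
  · exact hP0
  · have h := (X_pow_dvd_iff.1 hdP) d (by omega)
    rw [coeff_derivative] at h
    exact (mul_eq_zero.1 h).resolve_right (Nat.cast_add_one_ne_zero d)

/-- `logTruncInt N` is `N! · L_N` after base change to `ℚ`. [folklore] -/
theorem map_logTruncInt (N : ℕ) :
    (logTruncInt N).map (Int.castRingHom ℚ) = C (N ! : ℚ) * logTrunc N := by
  simp only [logTruncInt, logTrunc, Polynomial.map_sum, Polynomial.map_mul, Polynomial.map_pow,
    map_X, map_C, mul_sum]
  refine sum_congr rfl fun m hm => ?_
  rw [← mul_assoc, ← C_mul]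
  congr 2
  have hmN : m + 1 ≤ N := mem_range.1 hm
  have hdvd : (m + 1) ∣ N ! := Nat.dvd_factorial (Nat.succ_pos m) hmN
  have hm0 : ((m + 1 : ℕ) : ℚ) ≠ 0 := by exact_mod_cast Nat.succ_ne_zero m
  rw [eq_intCast, Int.cast_mul, Int.cast_pow, Int.cast_neg, Int.cast_one, Int.cast_natCast,
    Nat.cast_div hdvd hm0]
  push_cast
  field_simp

/-- **Truncated functional equation** over `ℤ`:
`X^(N+1) ∣ (N!·L_N)((1+X)ⁿ - 1) - n·(N!·L_N)(X)` in `ℤ[X]`. [folklore] -/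
theorem X_pow_dvd_int (n N : ℕ) :
    X ^ (N + 1) ∣ (logTruncInt N).comp ((1 + X) ^ n - 1) - (n : ℤ[X]) * logTruncInt N := by
  rw [X_pow_dvd_iff]
  intro d hd
  have hq := (X_pow_dvd_iff.1 (X_pow_dvd n N)) d hd
  have hmap : ((logTruncInt N).comp ((1 + X) ^ n - 1) - (n : ℤ[X]) * logTruncInt N).map
      (Int.castRingHom ℚ) =
      C (N ! : ℚ) * ((logTrunc N).comp ((1 + X) ^ n - 1) - (n : ℚ[X]) * logTrunc N) := by
    rw [Polynomial.map_sub, Polynomial.map_mul, Polynomial.map_natCast, Polynomial.map_comp,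
      map_logTruncInt, Polynomial.map_sub, Polynomial.map_pow, Polynomial.map_add,
      Polynomial.map_one, map_X, C_mul_comp, mul_sub, mul_left_comm]
  have hc := congrArg (fun q : ℚ[X] => q.coeff d) hmap
  simp only [coeff_map, eq_intCast, coeff_C_mul, hq, mul_zero, Int.cast_eq_zero] at hc
  exact hc

/-- Evaluation form: in any commutative ring `A`, for `v ∈ A` and `n N : ℕ` there is `c` with
`(N!·L_N)((1+v)ⁿ - 1) - n·(N!·L_N)(v) = v^(N+1)·c`. [folklore] -/
theorem exists_aeval_sub_eq {A : Type*} [CommRing A] (v : A) (n N : ℕ) :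
    ∃ c : A, aeval ((1 + v) ^ n - 1) (logTruncInt N) - n * aeval v (logTruncInt N) =
      v ^ (N + 1) * c := by
  obtain ⟨R, hR⟩ := X_pow_dvd_int n N
  refine ⟨aeval v R, ?_⟩
  have h := congrArg (aeval v) hR
  simp only [map_sub, map_mul, map_natCast, aeval_comp, map_pow, map_add, map_one, aeval_X] at h
  exact h

/-- A polynomial difference is divisible by the difference of the arguments:
`(N!·L_N)(x) - (N!·L_N)(y) ∈ (x - y)`. [folklore] -/
theorem sub_dvd_aeval_sub {A : Type*} [CommRing A] (x y : A) (N : ℕ) :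
    x - y ∣ aeval x (logTruncInt N) - aeval y (logTruncInt N) := by
  simpa only [aeval_def, eval₂_eq_eval_map] using
    Polynomial.sub_dvd_eval_sub x y ((logTruncInt N).map (algebraMap ℤ A))

/-- Over a `ℚ`-algebra, `(N!·L_N)(v) = N! · L_N(v)`. [folklore] -/
theorem aeval_logTruncInt {B : Type*} [CommRing B] [Algebra ℚ B] (v : B) (N : ℕ) :
    aeval v (logTruncInt N) = (N ! : B) * aeval v (logTrunc N) := by
  rw [← aeval_map_algebraMap ℚ v (logTruncInt N), algebraMap_int_eq, map_logTruncInt, map_mul,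
    aeval_C, map_natCast]

/-- The explicit sum `L_N(v) = Σ_{m<N} (-1)^m/(m+1) · v^(m+1)` in a `ℚ`-algebra. [folklore] -/
theorem aeval_logTrunc {B : Type*} [CommRing B] [Algebra ℚ B] (v : B) (N : ℕ) :
    aeval v (logTrunc N) =
      ∑ m ∈ range N, algebraMap ℚ B ((-1 : ℚ) ^ m / (m + 1)) * v ^ (m + 1) := by
  simp only [logTrunc, map_sum, map_mul, aeval_C, map_pow, aeval_X]

/-- `L_{N+1}(v) = L_N(v) + (-1)^N/(N+1) · v^(N+1)`. [folklore] -/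
theorem aeval_logTrunc_succ {B : Type*} [CommRing B] [Algebra ℚ B] (v : B) (N : ℕ) :
    aeval v (logTrunc (N + 1)) =
      aeval v (logTrunc N) + algebraMap ℚ B ((-1 : ℚ) ^ N / (N + 1)) * v ^ (N + 1) := by
  rw [aeval_logTrunc, aeval_logTrunc, sum_range_succ]

/-- `L_1(v) = v`, so `L_N(v) ≡ v` modulo `v²` for `N ≥ 1`: precisely
`L_N(v) - v ∈ (v²)` for `1 ≤ N`. [folklore] -/
theorem exists_aeval_logTrunc_sub_self {B : Type*} [CommRing B] [Algebra ℚ B] (v : B) {N : ℕ}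
    (hN : 1 ≤ N) : ∃ c : B, aeval v (logTrunc N) - v = v ^ 2 * c := by
  induction N, hN using Nat.le_induction with
  | base => exact ⟨0, by simp [aeval_logTrunc]⟩
  | succ N hN ih =>
    obtain ⟨c, hc⟩ := ih
    refine ⟨c + algebraMap ℚ B ((-1 : ℚ) ^ N / (N + 1)) * v ^ (N - 1), ?_⟩
    obtain ⟨k, rfl⟩ : ∃ k, N = k + 1 := ⟨N - 1, by omega⟩
    rw [aeval_logTrunc_succ, Nat.add_sub_cancel]
    linear_combination hc

/-- **`p`-adic continuity of `a ↦ (1+v)^a` modulo `v^(N+1)`**: in any commutative ring,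
`(1+v)^(p^K) - 1 = p^(K-N)·b + v^(N+1)·c` for some `b, c` (by Kummer's theorem
`v_p (p^K choose j) = K - v_p(j) ≥ K - N` for `1 ≤ j ≤ N`). [folklore] -/
theorem exists_one_add_pow_prime_pow (p : ℕ) [hp : Fact p.Prime] {A : Type*} [CommRing A]
    (v : A) (N K : ℕ) :
    ∃ b c : A, (1 + v) ^ (p ^ K) - 1 = (p : A) ^ (K - N) * b + v ^ (N + 1) * c := by
  have key : ∀ j ∈ range (p ^ K), v ^ (j + 1) * ((p ^ K).choose (j + 1) : A) ∈
      Ideal.span {(p : A) ^ (K - N), v ^ (N + 1)} := by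
    intro j hj
    by_cases hjN : j + 1 ≤ N
    · have hjK : j + 1 ≤ p ^ K := mem_range.1 hj
      have hfac := Nat.factorization_choose_prime_pow hp.out hjK (Nat.succ_ne_zero j)
      have hdvd : p ^ (K - N) ∣ (p ^ K).choose (j + 1) := by
        refine (Nat.pow_dvd_pow p ?_).trans (Nat.ordProj_dvd ((p ^ K).choose (j + 1)) p)
        have hlt : (j + 1).factorization p < j + 1 := Nat.factorization_lt p (Nat.succ_ne_zero j)
        rw [hfac]
        omega
      obtain ⟨d, hd⟩ := hdvd
      refine Ideal.mem_span_pair.2 ⟨v ^ (j + 1) * d, 0, ?_⟩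
      rw [hd]
      push_cast
      ring
    · have hlt : N + 1 ≤ j + 1 := by omega
      refine Ideal.mem_span_pair.2 ⟨0, v ^ (j + 1 - (N + 1)) * ((p ^ K).choose (j + 1) : A), ?_⟩
      rw [zero_mul, zero_add, mul_right_comm, ← pow_add, Nat.sub_add_cancel hlt]
  have hsum : (1 + v) ^ (p ^ K) - 1 ∈ Ideal.span {(p : A) ^ (K - N), v ^ (N + 1)} := by
    rw [add_comm (1 : A) v, add_pow, sum_range_succ']
    simp only [pow_zero, Nat.sub_zero, one_pow, Nat.choose_zero_right, Nat.cast_one, mul_one,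
      add_sub_cancel_right]
    exact Ideal.sum_mem _ key
  obtain ⟨b, c, h⟩ := Ideal.mem_span_pair.1 hsum
  exact ⟨b, c, by rw [← h]; ring⟩

end TruncatedLog

end Literature.NumberTheory.PAdicHodge

end
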